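import Literature.NumberTheory.GaloisRepresentations.GlobalReciprocityCharacterFormProofs
import Literature.NumberTheory.GaloisRepresentations.HeckeCharacterProofs
import Literature.NumberTheory.GaloisRepresentations.ModNCyclotomicCharacter
import HarnessLib

/-!
# The global reciprocity law for `ℚ` (Neukirch III (7.12) for `K = ℚ`, proved), and the
# character form of the existence theorem at almost all places

Topic `NumberTheory/GaloisRepresentations`; namespace `Literature.NumberTheory.GaloisRepresentations`.
Everything here is **proved**; no definition, no named fact (D-0026).  Sequel of
`GlobalReciprocityCharacterFormProofs` (`exists_isGlobalReciprocityMap K`, `K : Type`, from Artin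
reciprocity for characters + the character form (HG) of the existence theorem).

* `exists_forall_artinMapFamily_eq_one_imp_of_eventually`,
  `exists_ker_artinMapFamily_le_of_forall_isFiniteOrder`,
  `exists_isGlobalReciprocityMap_of_heckeCharacter_galois_eventually` — the reduction of
  `GlobalReciprocityCharacterFormProofs` with (HG) weakened to its **almost-all-places form**
  (HG′): *every finite-order Hecke character `η` of `K` has a rank-one Artin representation `ρ`
  with `ρ(Frob_v)` of characteristic polynomial `X - η(ϖ_v)` at all but finitely many places `v`
  at which `ρ` is unramified* (the rigidity `charHecke_unique` only ever used cofinitely many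
  places); this is the form in which Tate's dictionary "admissible `⟺` Grössencharakter"
  (Cassels–Fröhlich VII §3.7–3.8, 4.2, 5.1 (B), (D)) is usually stated.
* `Rat.exists_framedArtinRep_of_isFiniteOrder` — **(HG′) holds for `ℚ`**, and hence
* **`exists_isGlobalReciprocityMap_rat : exists_isGlobalReciprocityMap ℚ`** — *the global
  reciprocity law with its existence theorem for `K = ℚ`, unconditionally*: a continuous
  surjection `C_ℚ ↠ Γ_ℚ^ab` with kernel the infinitely divisible idele classes, pulling the open
  subgroups of `Γ_ℚ^ab` back onto all open subgroups of finite index of `C_ℚ` (Neukirch III (7.12)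
  with (6.13), (7.8); for `ℚ` this is the idelic form of the Kronecker–Weber theorem, Neukirch III
  (7.10)–(7.11): the norm groups of `C_ℚ` are the congruence subgroups, the class fields the
  cyclotomic fields).

The case `K = ℚ` of (HG′):

* `Rat.exists_framedArtinRep_of_isFiniteOrder` — **every Hecke character `ψ` of `ℚ` of finite
  order is, at almost all places, the Hecke character of a rank-one Artin representation**: there
  is `ρ : Γ_ℚ → GL_1(ℂ)` such that for all but finitely many `v`, `ρ` and `ψ` are unramified at `v`
  and `ρ(Frob_v)` has characteristic polynomial `X - ψ(ϖ_v)`.  Namely `ψ` comes from a Dirichlet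
  character `χ` mod `m` (`ψ(ϖ_p) = χ(p)` for `p ∤ m`; the tree's discharged
  `HeckeCharacter.exists_dirichletCharacter_of_isFiniteOrder_holds`, Neukirch VII (6.9)), and
  `ρ = χ ∘ χ_m` is `χ` regarded as a character of `Γ_ℚ` through the mod `m` cyclotomic character
  (`dirichletGaloisCharacter`, `FramedRep.ofCharacter`), unramified at `p ∤ m` with
  `ρ(Frob_p) = χ(p)` (`modNCyclotomicCharacter_eq_one_of_mem_inertia`,
  `modNCyclotomicCharacter_eq_residueCard_of_isArithFrobAt`) — Kronecker–Weber in character form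
  (Washington, *Introduction to Cyclotomic Fields*, Ch. 3: Dirichlet characters as characters of
  `Gal(ℚ(ζ_m)/ℚ)`; Neukirch, *Algebraic Number Theory* VII §6 (6.9) with V (1.10)/I (10.3): the
  Frobenius of `p ∤ m` in `ℚ(ζ_m)` is `ζ ↦ ζ^p`).

## References

* J. Neukirch, *Algebraic Number Theory*, Grundlehren 322, Springer 1999, Ch. VII §6 Prop. (6.9);
  Ch. I §10 (10.3). [NeukirchANT1999]
* L. C. Washington, *Introduction to Cyclotomic Fields*, 2nd ed., GTM 83, Springer 1997, Ch. 3.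
  [Washington1997]

## Mathlib / tree search

Tree: `HeckeCharacter.exists_dirichletCharacter_of_isFiniteOrder_holds`, `Rat.natCast_mem_asIdeal_iff`,
`Rat.residueCard_eq_natGenerator` (`HeckeCharacterProofs`); `dirichletGaloisCharacter`,
`coe_dirichletGaloisCharacter_apply`, `FramedRep.ofCharacter`, `FramedRep.ofCharacter_apply_coe`,
`FramedRep.charpoly_ofCharacter`, `modNCyclotomicCharacter_eq_one_of_mem_inertia`,
`modNCyclotomicCharacter_eq_residueCard_of_isArithFrobAt`,
`Rat.natCast_not_mem_of_mem_primesAbove_of_not_dvd` (`ModNCyclotomicCharacter`).  Mathlib: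
`Rat.HeightOneSpectrum.natGenerator`, `Ideal.finite_factors`.
`lean search 'exists_framedArtinRep_of_isFiniteOrder|heckeCharacter_galois'`: no prior hits.
-/

noncomputable section

open scoped NumberField Polynomial
open NumberField IsDedekindDomain Field Polynomial Filter Rat.HeightOneSpectrum

namespace Literature.NumberTheory.GaloisRepresentations

/-! ### The character-form reduction with (HG) at almost all places -/

section Eventually

variable {K : Type} [Field K] [NumberField K]

/-- **Under (HG′), a finite-order Hecke character is `χ ∘ ψ_{L|K}`** (almost-all-places version of
`exists_forall_artinMapFamily_eq_one_imp`): if `ρ(Frob_v)` has characteristic polynomial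
`X - η(ϖ_v)` at all but finitely many places `v` where `ρ` is unramified, then writing `ρ = χ ∘ r_L`
(`exists_inflateCharacter_eq`) one has `η = ω_χ` (`charHecke_unique`), so `ker ψ_{L|K} ≤ ker η`.
[cite: CasselsFrohlichANT1967, Ch. VII Prop. 4.1 (uniqueness) and §4.2 Corollary] -/
theorem exists_forall_artinMapFamily_eq_one_imp_of_eventually (hR : artinReciprocity_character)
    {η : HeckeCharacter K} {ρ : FramedArtinRep K 1}
    (hρ : ∀ᶠ v : HeightOneSpectrum (𝓞 K) in cofinite,
      ρ.IsUnramifiedAt v → ρ.HasFrobCharpolyAt v (X - C (η.valueAtUniformizer v))) :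
    ∃ (L : IntermediateField K (AlgebraicClosure K)) (_ : FiniteDimensional K L)
      (_ : IsAbelianGalois K L),
      ∀ x : ideleGroup K, artinMapFamily K hR L (QuotientGroup.mk x) = 1 → η x = 1 := by
  obtain ⟨L, hfin, hab, χ, hLχ⟩ := exists_inflateCharacter_eq ρ
  haveI := hfin
  haveI := hab
  haveI : NumberField L := NumberField.of_module_finite K L
  have hηχ : η = charHecke L χ hR := by
    refine charHecke_unique L χ hR ?_
    filter_upwards [eventually_isUnramifiedIn (K := K) L, hρ] with v hv hρv
    have hρv' : ρ.IsUnramifiedAt v := by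
      rw [← hLχ]
      exact inflateCharacter_isUnramifiedAt L χ hv
    have h2 := hρv hρv'
    rw [← hLχ] at h2
    exact eq_of_inflateCharacter_hasFrobCharpolyAt L χ (commute_of_isAbelianGalois L) hv h2
  refine ⟨L, hfin, hab, fun x hx => ?_⟩
  rw [artinMapFamily_eq, artinClassMap_mk] at hx
  rw [hηχ, ← apply_artinIdeleMap L hR χ x, hx, map_one]

/-- **(E) from "every finite-order Hecke character dies on some `ker ψ_{L|K}`"** — the duality step of
`exists_ker_artinMapFamily_le_of_heckeCharacter_galois`, isolated: if for every Hecke character `η`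
of finite order there is a finite abelian `L ⊆ K̄` with `ψ_{L|K}(x) = 1 ⇒ η(x) = 1`, then every open
subgroup `N` of finite index of `C_K` contains `ker ψ_{M|K}` for a finite abelian `M` (the compositum
of the `L_φ` over the characters `φ` of `𝕀_K/Ñ ≅ C_K/N`, which separate points).
[cite: CasselsFrohlichANT1967, Ch. VII §5.1 Main Theorem (B), (D)] -/
theorem exists_ker_artinMapFamily_le_of_forall_isFiniteOrder (hR : artinReciprocity_character)
    (hker : ∀ η : HeckeCharacter K, η.IsFiniteOrder →
      ∃ (L : IntermediateField K (AlgebraicClosure K)) (_ : FiniteDimensional K L)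
        (_ : IsAbelianGalois K L),
        ∀ x : ideleGroup K, artinMapFamily K hR L (QuotientGroup.mk x) = 1 → η x = 1)
    (N : Subgroup (ideleGroup K ⧸ principalIdeles K))
    (hN : IsOpen (N : Set (ideleGroup K ⧸ principalIdeles K))) (hfi : N.FiniteIndex) :
    ∃ (M : IntermediateField K (AlgebraicClosure K)) (_ : FiniteDimensional K M)
      (_ : IsAbelianGalois K M), (artinMapFamily K hR M).ker ≤ N := by
  classical
  -- the preimage `Ñ` of `N` in `𝕀_K`: open, of finite index, containing `Kˣ`
  set Ñ : Subgroup (ideleGroup K) := N.comap (QuotientGroup.mk' (principalIdeles K)) with hÑdef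
  have hP : principalIdeles K ≤ Ñ := fun x hx => by
    rw [hÑdef, Subgroup.mem_comap, QuotientGroup.mk'_apply, (QuotientGroup.eq_one_iff x).mpr hx]
    exact N.one_mem
  have hÑo : IsOpen (Ñ : Set (ideleGroup K)) := hN.preimage QuotientGroup.continuous_mk
  haveI hÑfi : Ñ.FiniteIndex := by
    refine ⟨fun h0 => hfi.index_ne_zero ?_⟩
    have h := Subgroup.index_comap_of_surjective (H := N)
      (QuotientGroup.mk'_surjective (principalIdeles K))
    exact h.symm.trans h0
  haveI : Finite (ideleGroup K ⧸ Ñ) := Subgroup.finite_quotient_of_finiteIndex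
  haveI := hasEnoughRootsOfUnity_exponent_of_finite (ideleGroup K ⧸ Ñ)
  haveI : Finite ((ideleGroup K ⧸ Ñ) →* ℂˣ) :=
    Finite.of_equiv (ideleGroup K ⧸ Ñ)
      (CommGroup.monoidHom_mulEquiv_of_hasEnoughRootsOfUnity (ideleGroup K ⧸ Ñ) ℂ).some.symm.toEquiv
  haveI : Fintype ((ideleGroup K ⧸ Ñ) →* ℂˣ) := Fintype.ofFinite _
  -- one finite abelian `L_φ` per character `φ` of `𝕀_K / Ñ`
  have hφ : ∀ φ : (ideleGroup K ⧸ Ñ) →* ℂˣ,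
      ∃ (L : IntermediateField K (AlgebraicClosure K)) (_ : FiniteDimensional K L)
        (_ : IsAbelianGalois K L),
        ∀ x : ideleGroup K, artinMapFamily K hR L (QuotientGroup.mk x) = 1 →
          φ (x : ideleGroup K ⧸ Ñ) = 1 := by
    intro φ
    obtain ⟨L, h1, h2, h3⟩ :=
      hker (heckeOfIdeleQuotientChar Ñ hP hÑo φ) (isFiniteOrder_heckeOfIdeleQuotientChar Ñ hP hÑo φ)
    exact ⟨L, h1, h2, fun x hx => by
      rw [← heckeOfIdeleQuotientChar_apply Ñ hP hÑo φ x]; exact h3 x hx⟩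
  choose Lφ hfin hab hLφ using hφ
  -- their compositum `M`
  refine ⟨Finset.univ.sup Lφ, ?_⟩
  have hM : FiniteDimensional K (Finset.univ.sup Lφ : IntermediateField K (AlgebraicClosure K)) ∧
      IsAbelianGalois K (Finset.univ.sup Lφ : IntermediateField K (AlgebraicClosure K)) := by
    refine Finset.sup_induction (p := fun E : IntermediateField K (AlgebraicClosure K) =>
      FiniteDimensional K E ∧ IsAbelianGalois K E) ⟨inferInstance, inferInstance⟩ ?_ ?_
    · rintro E₁ ⟨h₁, h₁'⟩ E₂ ⟨h₂, h₂'⟩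
      haveI := h₁; haveI := h₁'; haveI := h₂; haveI := h₂'
      exact ⟨inferInstance, isAbelianGalois_sup E₁ E₂⟩
    · intro φ _
      exact ⟨hfin φ, hab φ⟩
  haveI := hM.1
  haveI := hM.2
  refine ⟨hM.1, hM.2, fun a ha => ?_⟩
  induction a using QuotientGroup.induction_on with
  | H x =>
    have hx : ∀ φ : (ideleGroup K ⧸ Ñ) →* ℂˣ, φ (x : ideleGroup K ⧸ Ñ) = 1 := by
      intro φ
      haveI := hfin φ
      haveI := hab φ
      exact hLφ φ x (ker_artinMapFamily_antitone hR (Finset.le_sup (Finset.mem_univ φ)) ha)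
    have h1 : (x : ideleGroup K ⧸ Ñ) = 1 :=
      (CommGroup.forall_apply_eq_apply_iff (ideleGroup K ⧸ Ñ) (M := ℂ)).mp fun φ => by
        rw [hx φ, map_one]
    have h2 : x ∈ Ñ := (QuotientGroup.eq_one_iff x).mp h1
    rw [hÑdef, Subgroup.mem_comap] at h2
    exact h2

/-- **`exists_isGlobalReciprocityMap K` from `artinReciprocity_character` and (HG′)** (`K : Type`):
as `exists_isGlobalReciprocityMap_of_heckeCharacter_galois`, with (HG) only required at almost all
places where the Artin representation is unramified.
[cite: Neukirch2013, Part III Thm. (7.12)] [cite: CasselsFrohlichANT1967, Ch. VII §5.1 Main Theorem (A), (B), (D)] -/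
theorem exists_isGlobalReciprocityMap_of_heckeCharacter_galois_eventually
    (hR : artinReciprocity_character)
    (hHG : ∀ η : HeckeCharacter K, η.IsFiniteOrder → ∃ ρ : FramedArtinRep K 1,
      ∀ᶠ v : HeightOneSpectrum (𝓞 K) in cofinite,
        ρ.IsUnramifiedAt v → ρ.HasFrobCharpolyAt v (X - C (η.valueAtUniformizer v))) :
    exists_isGlobalReciprocityMap K :=
  exists_isGlobalReciprocityMap_of_ker_cofinal hR fun N hN hfi =>
    exists_ker_artinMapFamily_le_of_forall_isFiniteOrder hR
      (fun η hη => by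
        obtain ⟨ρ, hρ⟩ := hHG η hη
        exact exists_forall_artinMapFamily_eq_one_imp_of_eventually hR hρ)
      N hN hfi

end Eventually

/-! ### `K = ℚ` -/

/-- The places of `ℚ` dividing a non-zero natural number are finite in number. [folklore] -/
theorem Rat.finite_setOf_natGenerator_dvd {m : ℕ} (hm : m ≠ 0) :
    {v : HeightOneSpectrum (𝓞 ℚ) | natGenerator v ∣ m}.Finite := by
  have h : {v : HeightOneSpectrum (𝓞 ℚ) | natGenerator v ∣ m} ⊆
      {v : HeightOneSpectrum (𝓞 ℚ) | v.asIdeal ∣ Ideal.span {(m : 𝓞 ℚ)}} := by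
    intro v hv
    rw [Set.mem_setOf_eq] at hv ⊢
    rw [Ideal.dvd_span_singleton]
    exact (Rat.natCast_mem_asIdeal_iff v).mpr hv
  refine (Ideal.finite_factors ?_).subset h
  rw [Ideal.zero_eq_bot, Ne, Ideal.span_singleton_eq_bot]
  exact_mod_cast hm

/-- **(HG) for `ℚ`, almost-all-places form: every finite-order Hecke character of `ℚ` is the Hecke
character of a rank-one Artin representation at almost all places.**  For `ψ` of finite order
there is `ρ : Γ_ℚ → GL_1(ℂ)` (namely `χ ∘ χ_m` for the Dirichlet character `χ` mod `m` of `ψ`) such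
that for all but finitely many finite places `v` (those with `p_v ∤ m`): `ρ` is unramified at `v`,
`ψ` is unramified at `v`, and every arithmetic Frobenius at `v` has characteristic polynomial
`X - ψ(ϖ_v)` under `ρ`.
[cite: NeukirchANT1999, Ch. VII Prop. (6.9)] [cite: Washington1997, Ch. 3] -/
theorem Rat.exists_framedArtinRep_of_isFiniteOrder (ψ : HeckeCharacter ℚ) (hψ : ψ.IsFiniteOrder) :
    ∃ ρ : FramedArtinRep ℚ 1, ∀ᶠ v : HeightOneSpectrum (𝓞 ℚ) in cofinite,
      ρ.IsUnramifiedAt v ∧ ψ.IsUnramifiedAt v ∧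
        ρ.HasFrobCharpolyAt v (X - C (ψ.valueAtUniformizer v)) := by
  obtain ⟨m, hm, χ, hχ⟩ := HeckeCharacter.exists_dirichletCharacter_of_isFiniteOrder_holds ψ hψ
  haveI := hm
  refine ⟨FramedRep.ofCharacter (dirichletGaloisCharacter ℚ χ), ?_⟩
  have hfin := Rat.finite_setOf_natGenerator_dvd (NeZero.ne m)
  rw [eventually_cofinite]
  refine hfin.subset fun v hv => ?_
  rw [Set.mem_setOf_eq] at hv ⊢
  by_contra hpm
  apply hv
  have hvm : (m : 𝓞 ℚ) ∉ v.asIdeal := fun h => hpm ((Rat.natCast_mem_asIdeal_iff v).mp h)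
  have hpm' : ¬ ((primesEquiv v : Nat.Primes) : ℕ) ∣ m := hpm
  obtain ⟨hunr, hval⟩ := hχ v hvm
  refine ⟨?_, hunr, ?_⟩
  · intro 𝔓 h𝔓 σ hσ
    haveI : 𝔓.IsPrime := h𝔓.1
    have h1 := modNCyclotomicCharacter_eq_one_of_mem_inertia (K := ℚ) (N := m)
      (Rat.natCast_not_mem_of_mem_primesAbove_of_not_dvd h𝔓 hpm') hσ
    apply Units.ext
    ext i j
    rw [Subsingleton.elim i j, FramedRep.ofCharacter_apply_coe, coe_dirichletGaloisCharacter_apply,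
      h1, Units.val_one, map_one, Units.val_one, Matrix.one_apply_eq]
  · intro 𝔓 h𝔓 σ hσ
    haveI : 𝔓.IsPrime := h𝔓.1
    have h1 := modNCyclotomicCharacter_eq_residueCard_of_isArithFrobAt (K := ℚ) (N := m) h𝔓
      (Rat.natCast_not_mem_of_mem_primesAbove_of_not_dvd h𝔓 hpm') hσ
    rw [FramedRep.charpoly_ofCharacter, coe_dirichletGaloisCharacter_apply, h1, hval]

/-- **The global reciprocity law for `ℚ` — proved.**  `exists_isGlobalReciprocityMap ℚ`
(Neukirch, *Class Field Theory — The Bonn Lectures*, Part III Thm. (7.12) with (6.13), (7.8), for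
`K = ℚ`): there is a homomorphism `θ : C_ℚ = 𝕀_ℚ/ℚˣ → Γ_ℚ^ab` which is continuous and surjective,
whose kernel is the group of infinitely divisible idele classes (the connected component
`ℝ₊ˣ`), and such that every open subgroup of finite index of `C_ℚ` is the preimage of an open
subgroup of `Γ_ℚ^ab` — namely `θ = lim ψ_{L|ℚ}` over the finite abelian `L ⊆ ℚ̄`, the Artin maps of
the tree (`artinMapFamily`, from `artinReciprocity_character_holds`).  The existence clause is the
idelic Kronecker–Weber theorem (Neukirch III (7.10)–(7.11): the class fields of `ℚ` are the
subfields of the cyclotomic fields), entering here through (HG′) for `ℚ`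
(`Rat.exists_framedArtinRep_of_isFiniteOrder`: finite-order Hecke characters of `ℚ` are Dirichlet
characters, which are characters of `Gal(ℚ(ζ_m)/ℚ)`).
[cite: Neukirch2013, Part III Thm. (7.12), (7.10), (7.11)] [cite: CasselsFrohlichANT1967, Ch. VII §5.1 Main Theorem] -/
theorem exists_isGlobalReciprocityMap_rat : exists_isGlobalReciprocityMap ℚ :=
  exists_isGlobalReciprocityMap_of_heckeCharacter_galois_eventually artinReciprocity_character_holds
    fun η hη => by
      obtain ⟨ρ, hρ⟩ := Rat.exists_framedArtinRep_of_isFiniteOrder η hη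
      exact ⟨ρ, hρ.mono fun v hv _ => hv.2.2⟩

end Literature.NumberTheory.GaloisRepresentations

end
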